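import Summits.BirchSwinnertonDyer.BirchSwinnertonDyer.Theorems.ByReductionTypeAtTwoMultTransportP49KernelAssembly
import Summits.BirchSwinnertonDyer.BirchSwinnertonDyer.Theorems.ByReductionTypeAtTwoMultTransportP49KernelLOC
import Summits.BirchSwinnertonDyer.BirchSwinnertonDyer.Theorems.ByReductionTypeAtTwoMultTransportP49KernelInflation
import Summits.BirchSwinnertonDyer.BirchSwinnertonDyer.Theorems.SignedBaseChangeAnticyclotomicEisensteinDivisibilityCurveModel
import HarnessLib

/-!
# T-42-mult in the kernel, XLIX — P49-KERNEL (7): Greenberg's Prop. 4.9 over `ℚ` from the engine facts and the ONE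
# remaining input LEO(`E[p^∞] ⊗ Λ^*`) — inputs (I2), (I3), (I4) of `prop49_of_kernelInputs` SUPPLIED

Cell `bsd-2adic` (run/shared/lean/pub/bsd-2adic/), seat `bsd-2adic-t42` GEN 18 (pen RC-315 (b); memo
`t42/DESIGN-T42-ADDENDUM-21` §A21.3–A21.5). HONEST FRAMING: research route; THEOREMS ONLY (no `def`, no named fact,
no instance, no `sorry`); nothing booked; BSD is not proved by any of this. PARTITION: X5@2 multiplicative GV-transport
rows (K4ᵐ B1·O1; PRINT binder P49 of `multCongruenceTransportAtTwo_of_print49`) × all p — reduces-the-named-input-of;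
bears_on K4 19922 / 19923 (`--supports stmt-BirchSwinnertonDyer-19923`).

`P49Kernel.prop49_of_kernelInputs` (file XLIII) proves Greenberg's LNM 1716 Prop. 4.9 over `ℚ`
(`prop49_noFiniteSubmodule_H1Sigma`) from Greenberg-2006 Prop. 5.2 / Prop. 6.3 / Thm. 1 (i) and Poitou–Tate 17.13 (a)(b)
(named facts) and a bundle `hIn` of four inputs at Greenberg's arena `G_{ℚ,S}`, `S = Σ₀ ∪ {p}`, `𝒜 = E[p^∞] ⊗ Λ^*(κ̄⁻¹)`:
(I1) LEO, (I2) LOC_η⁽¹⁾ at `η ∋ p`, (I3) LOC⁽²⁾ on `Σ`, (I4) the oriented Shapiro bridge. Files XLIV–XLVIII proved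
(I2) (`loc1_bigRep_primaryTorsion_rat`), (I3) (`loc2_bigRep_primaryTorsion`) and (I4) (`exists_shapiro_bridge`); the model
`ρ₀` of `E[p^∞]` over `G_{ℚ,S}` is the curve-model file's `exists_continuousRep_primaryTorsion` (Néron–Ogg–Shafarevich:
`N_S` fixes `E[p^∞]`, `smul_primaryTorsion_eq_of_mem_ramificationSubgroup`). This file PLUGS them in:

* `prop49_of_LEO` — `prop49_noFiniteSubmodule_H1Sigma` follows from the five named engine facts and the single remaining
  input **(I1) LEO**: at the binders of Prop. 4.9 (`X(E/ℚ_∞)` torsion), for every descended model `ρ₀` of `E[p^∞]` over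
  `G_{ℚ,S}` (`S = Σ₀ ∪ {p}`), `Ш²(ℚ, Σ, E[p^∞] ⊗ Λ^*(κ̄⁻¹))` is `Λ`-cotorsion — Greenberg's corank count "`H²(F_Σ/F_∞, E[p^∞])`
  has `Λ`-corank `0`" (LNM 1716 p. 114), the successor's target.

References: [GreenbergLNM1716] Prop. 4.9 and its proof pp. 112–118; [Greenberg2006] Thm. 1, Props. 2.4, 3.2, 4.1;
[Greenberg2016Selmer] Prop. 2.6.1, §4.3; [SilvermanAEC2009] VII.4.1, VII.7.1.
-/

set_option autoImplicit false
set_option linter.dupNamespace false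

noncomputable section

open scoped Classical

namespace Summit.BirchSwinnertonDyer.BirchSwinnertonDyer.Theorems.P49Kernel

open NumberField IsDedekindDomain Field WeierstrassCurve
  Literature.NumberTheory.EllipticCurves Literature.NumberTheory.EllipticCurves.BigGaloisRep
  Literature.NumberTheory.EllipticCurves.Greenberg1999 Literature.NumberTheory.EllipticCurves.GreenbergVatsal2000
  Literature.NumberTheory.GaloisRepresentations Literature.NumberTheory.GaloisCohomology
  Literature.NumberTheory.IwasawaTheory.Greenberg2006 Literature.NumberTheory.IwasawaTheory.Greenberg2016
  Summit.BirchSwinnertonDyer.BirchSwinnertonDyer.Theorems.SignedBaseChangeAcDivCurveModel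

/-! ## §1. A finite place above `p` -/

section Place

variable {K : Type} [Field K] [NumberField K] (p : ℕ) [Fact p.Prime]

/-- Every number field has a finite place above the rational prime `p` (lying-over for `ℤ ⊆ 𝓞 K`; adapted from the
tree's `PublishedInputsGreenbergRelaxedCountHolds.exists_place_natCast_mem`). Neukirch, *ANT*, I §8. -/
private theorem exists_place_natCast_mem' : ∃ v : HeightOneSpectrum (𝓞 K), ((p : ℕ) : 𝓞 K) ∈ v.asIdeal := by
  have hp : p.Prime := Fact.out
  have hp' : Prime (p : ℤ) := Nat.prime_iff_prime_int.mp hp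
  haveI : (Ideal.span {(p : ℤ)}).IsPrime := (Ideal.span_singleton_prime hp'.ne_zero).mpr hp'
  have hinj : Function.Injective (algebraMap ℤ (𝓞 K)) := (algebraMap ℤ (𝓞 K)).injective_int
  obtain ⟨Q, -, hQ, hQp⟩ := Ideal.exists_ideal_over_prime_of_isIntegral
    (S := 𝓞 K) (Ideal.span {(p : ℤ)}) ⊥
    (by
      rw [← RingHom.ker_eq_comap_bot, (RingHom.injective_iff_ker_eq_bot _).mp hinj]
      exact bot_le)
  have hmem : (p : ℤ) ∈ Q.comap (algebraMap ℤ (𝓞 K)) := by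
    rw [hQp]
    exact Ideal.mem_span_singleton_self _
  have hQne : Q ≠ ⊥ := by
    intro hQbot
    rw [hQbot, Ideal.mem_comap, Ideal.mem_bot] at hmem
    exact hp'.ne_zero (hinj (by rw [hmem, map_zero]))
  refine ⟨⟨Q, hQ, hQne⟩, ?_⟩
  have := Ideal.mem_comap.mp hmem
  rwa [map_natCast] at this

end Place

/-! ## §2. Prop. 4.9 over `ℚ` from the engine facts and LEO -/

section Rat

/-- **Greenberg's Prop. 4.9 over `ℚ` from the five named engine facts and the ONE remaining input (I1) LEO.** GRANTED
Greenberg 2006 Prop. 5.2 / Prop. 6.3 / Thm. 1 (i) and Poitou–Tate 17.13 (a)(b) for `ℚ` (named facts), and GIVEN, at the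
binders of LNM 1716 Prop. 4.9 (`W/ℚ` minimal, `κ` cyclotomic with topological generator `γ`, `Σ₀` with good reduction
outside `Σ₀ ∪ {p}`, `X(E/ℚ_∞)` torsion) and for every continuous `ℤ_p`-linear model `ρ₀` of `E[p^∞]` over `G_{ℚ,S}`,
`S = Σ₀ ∪ {p}`, with `ρ₀(σ mod N_S) = σ`, the hypothesis **LEO: `Ш²(ℚ, Σ, E[p^∞] ⊗ Λ^*(κ̄⁻¹))` is `Λ`-cotorsion**
("`H²(F_Σ/F_∞, E[p^∞])` has `Λ`-corank `0`", LNM 1716 p. 114 — by Shapiro the same module), Prop. 4.9 holds: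
`H¹(ℚ_Σ/ℚ_∞, E[p^∞])` has no proper `Λ`-submodule of finite index. Proof: `prop49_of_kernelInputs` with
`S := Σ₀ ∪ {v ∣ p}` (finite, `finite_union_setOf_natCast_mem`), `ρ₀` from `exists_continuousRep_primaryTorsion`
(Néron–Ogg–Shafarevich, `smul_primaryTorsion_eq_of_mem_ramificationSubgroup`), `𝒜 := bigRep κ̄ ρ₀`, (I2)
`loc1_bigRep_primaryTorsion_rat` at a place `η ∋ p`, (I3) `loc2_bigRep_primaryTorsion`, (I4) `exists_shapiro_bridge`
(`bigRep_lift_mk_apply`). [cite: GreenbergLNM1716, Prop. 4.9 and its proof, pp. 112–118]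
[cite: Greenberg2006, Thm. 1, Prop. 2.4, Prop. 3.2] [cite: Greenberg2016Selmer, Prop. 2.6.1, §4.3 p. 20] -/
theorem prop49_of_LEO
    (h52 : prop52_localH2_torsionBy_injective) (h63 : prop63_shaAway_smul_surjective)
    (hT1 : thm1_sha2_isCoreflexive)
    (hPTb : poitouTate_shaRestricted_tateDual ℚ) (hPTa : poitouTate_restricted_three_le ℚ)
    (hLEO : ∀ (W : WeierstrassCurve ℚ) [W.IsElliptic] [W.IsGloballyMinimal] (p : ℕ) [Fact p.Prime]
      (κ : ZpExtension ℚ p) (γ : absoluteGaloisGroup ℚ), κ.IsCyclotomic → κ.IsTopGenerator γ →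
      ∀ (S₀ : Finset (HeightOneSpectrum (𝓞 ℚ))),
        (∀ v : HeightOneSpectrum (𝓞 ℚ), v ∉ S₀ → ((p : ℕ) : 𝓞 ℚ) ∉ v.asIdeal →
          W.HasGoodReductionAt v) →
      ∀ (D : W.SelmerDualData κ γ), D.IsTorsion →
      letI : TopologicalSpace (IwasawaAlgebra p) := ⊥
      ∀ [DiscreteTopology (IwasawaAlgebra p)] [IsTopologicalRing (IwasawaAlgebra p)]
        (ρ₀ : ContinuousRep (GaloisGroupUnramifiedOutside ℚ
            ((↑S₀ : Set (HeightOneSpectrum (𝓞 ℚ))) ∪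
              {v : HeightOneSpectrum (𝓞 ℚ) | ((p : ℕ) : 𝓞 ℚ) ∈ v.asIdeal}))
          ℤ_[p] (PrimaryTorsion W.geomPoints p)),
        (∀ (σ : absoluteGaloisGroup ℚ) (P : PrimaryTorsion W.geomPoints p),
          ρ₀ (toUnramifiedQuot ℚ _ σ) P = σ • P) →
        LEO ((↑S₀ : Set (HeightOneSpectrum (𝓞 ℚ))) ∪
            {v : HeightOneSpectrum (𝓞 ℚ) | ((p : ℕ) : 𝓞 ℚ) ∈ v.asIdeal})
          (bigRep (κ.liftUnramifiedOutside _ (mem_union_setOf_natCast_mem p S₀)) ρ₀)) :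
    prop49_noFiniteSubmodule_H1Sigma := by
  refine prop49_of_kernelInputs h52 h63 hT1 hPTb hPTa ?_
  intro W _ _ p _ κ γ hκ hγ S₀ hbad D hD
  letI : TopologicalSpace (IwasawaAlgebra p) := ⊥
  intro _ _
  -- the set `S = Σ₀ ∪ {v ∣ p}` and the descended model `ρ₀` of `E[p^∞]` over `G_{ℚ,S}`
  have hS : (((↑S₀ : Set (HeightOneSpectrum (𝓞 ℚ))) ∪
      {v : HeightOneSpectrum (𝓞 ℚ) | ((p : ℕ) : 𝓞 ℚ) ∈ v.asIdeal})).Finite :=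
    finite_union_setOf_natCast_mem p (Fact.out : p.Prime).ne_zero S₀
  have hSp := mem_union_setOf_natCast_mem (K := ℚ) p S₀
  have hSbad : ∀ w : HeightOneSpectrum (𝓞 ℚ), ¬ W.HasGoodReductionAt w →
      w ∈ ((↑S₀ : Set (HeightOneSpectrum (𝓞 ℚ))) ∪
        {v : HeightOneSpectrum (𝓞 ℚ) | ((p : ℕ) : 𝓞 ℚ) ∈ v.asIdeal}) := fun w hw ↦ by
    by_contra h
    exact hw (hbad w (fun h' ↦ h (Or.inl h')) (fun h' ↦ h (Or.inr h')))
  have hNS : ∀ n ∈ ramificationSubgroup ℚ (((↑S₀ : Set (HeightOneSpectrum (𝓞 ℚ))) ∪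
      {v : HeightOneSpectrum (𝓞 ℚ) | ((p : ℕ) : 𝓞 ℚ) ∈ v.asIdeal})),
      ∀ P : PrimaryTorsion W.geomPoints p, n • P = P := fun n hn P ↦
    smul_primaryTorsion_eq_of_mem_ramificationSubgroup W p _ hSbad hSp hn P
  obtain ⟨ρ₀, hρ₀⟩ := exists_continuousRep_primaryTorsion W p _ hNS
  obtain ⟨η, hη⟩ := exists_place_natCast_mem' (K := ℚ) p
  -- (I4) the Shapiro bridge
  obtain ⟨Sh, hSh⟩ := exists_shapiro_bridge W κ γ hγ (S₀ := (↑S₀ : Set (HeightOneSpectrum (𝓞 ℚ))))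
    Set.subset_union_left hSp (fun v hv₀ hpv hv ↦ hv.elim hv₀ hpv) hNS
    (bigRep (κ.liftUnramifiedOutside _ hSp) ρ₀) (bigRep_lift_mk_apply W κ hSp ρ₀ hρ₀)
  exact ⟨_, hS, hSp, bigRep (κ.liftUnramifiedOutside _ hSp) ρ₀, η, Sh,
    hLEO W p κ γ hκ hγ S₀ hbad D hD ρ₀ hρ₀, hSp η hη, loc1_bigRep_primaryTorsion_rat hκ hSp W ρ₀ hη,
    fun v _ ↦ loc2_bigRep_primaryTorsion _ W ρ₀ v, hSh⟩

end Rat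

end Summit.BirchSwinnertonDyer.BirchSwinnertonDyer.Theorems.P49Kernel

end
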